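import Summits.FinalStateConjecture.FinalStateConjecture.Theorems.ZeroEnergyKerrOrBombSymplecticDualOfTheBombSig
import Literature.Geometry.Lorentzian.LinearizedRicci
import Literature.Geometry.Lorentzian.KillingModeStability
import Literature.Geometry.Lorentzian.LeviCivitaCovDerivProofs
import Literature.Geometry.Lorentzian.CurvatureSymmetries
import Literature.Geometry.Lorentzian.CausalityOpennessProofs
import HarnessLib

/-!
# Route ZeroEnergyKerrOrBomb · crux `StationaryLimitReduction`, line `symplectic-dual-of-the-bomb`:
# stub `stub_probeUniversality`, wave 3 — the gauge calculus of a scalar black-hole bomb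

Helper file (lead a2, wave 3) for the registered stub `stub_probeUniversality : Sig.stub_probeUniversality`
of crux stmt-FinalStateConjecture-10021 (the Bridge "a scalar black-hole bomb is a gravitational bomb":
`InTelescope 𝓑 → 𝓗⁺ ⊆ range A → ¬ ModeStable 𝓑 → ∃ ν > 0, ϖ, h₁, h₂, IsGravitationalModePair 𝓑 A ν ϖ h₁ h₂`).
It is the tensor calculus behind the HONESTY CERTIFICATE of the companion file
`…StationaryLimitReductionProbeUniversalityWave3.lean`: from a scalar Killing-mode pair `(ψ, χ)` of rate
`ν + iϖ` of a Killing field `T` (`Tψ = νψ − ϖχ`, `Tχ = ϖψ + νχ` on an open set) one MANUFACTURES the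
pure-gauge tensor pair `hᵢ := 𝓛_{ψᵢT} g = dψᵢ ⊗ T♭ + T♭ ⊗ dψᵢ`, and this pair satisfies the Killing
eigen-equations of `IsGravitationalModePair` verbatim, `𝓛_T h₁ = ν h₁ − ϖ h₂`, `𝓛_T h₂ = ϖ h₁ + ν h₂` —
so that only the gauge clause of that definition stands between `¬ ModeStable` and a cheap witness.

* §1 (any `C^n` pseudo-Riemannian metric with the Levi-Civita API of `LeviCivita.lean` /
  `LinearizedRicci.lean`): `lieDerivBilin_smul_val_apply` — `𝓛_{fX} g = f 𝓛_X g + df ⊗ X♭ + X♭ ⊗ df`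
  (Leibniz rule of `∇`, `∇g = 0`); `lieDerivBilin_smul_val_apply_of_isKillingField` — for Killing `T`,
  `𝓛_{fT} g = df ⊗ T♭ + T♭ ⊗ df`; `covDeriv₂_apply_extend_of_forall` — the tensor `∇k` of
  `LeviCivita.lean` takes its honest value `Z(k(X,Y)) − k(∇_Z X, Y) − k(X, ∇_Z Y)` as soon as
  `y ↦ k_y(X_y, Y_y)` is differentiable at `x` for all fields `X, Y` differentiable at `x` (a weaker
  hypothesis than that of the named fact `covDeriv₂_apply`); the main identity `lieDerivBilin_lieDerivBilin_smul_val`: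
  `𝓛_T 𝓛_{ψT} g = ν 𝓛_{ψT} g − ϖ 𝓛_{χT} g` at every point of an open set on which `ψ, χ ∈ C²` and
  `Tψ = νψ − ϖχ`, `n ≥ 2` — from the tree's `∇`-formula for `𝓛` (Wald (C.2.14)) by the product rule,
  metric compatibility, torsion-freeness `[T, Ṽ] = ∇_T Ṽ − ∇_Ṽ T`, the bracket-as-commutator lemma
  `dψ([T, Ṽ]) = T(Ṽψ) − Ṽ(Tψ)` (`mvfderiv_apply_mlieBracket`) and Killing's equation, twice.
* §2 the registered helper `lieDerivBilin_smul_killing_eigenpair`: the same on a stationary hole `𝓑`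
  (`T = 𝓑.killing`; the d.o.c. is open on the boundaryless carrier), hypotheses = the regularity and
  eigen-equation clauses (i), (iii) of `StationaryAFBlackHole.IsKillingModePair`, conclusion = clause (d)
  (Killing eigen-equations) of `IsGravitationalModePair` for the gauge pair `(𝓛_{ψT} g, 𝓛_{χT} g)`.

No named fact is introduced (the tree facts `covDeriv₂_val`, `isLeviCivita_leviCivita` used are `_holds`).
-/

-- every `Summit.FinalStateConjecture.FinalStateConjecture.…` name repeats the summit = sub-problem segment (D-0017 layout)
set_option linter.dupNamespace false
set_option maxSynthPendingDepth 3

noncomputable section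

open scoped Manifold ContDiff Topology
open Set Bundle Filter FiberBundle Literature.Geometry.Lorentzian

namespace Summit.FinalStateConjecture.FinalStateConjecture.Theorems.SymplecticDualOfTheBomb

open Summit.FinalStateConjecture.FinalStateConjecture.Theorems.OneLockedExplosion

/-! ## §1 `𝓛_{fX} g`, the honest value of `∇k`, and `𝓛_T 𝓛_{ψT} g` for a Killing eigenfunction `ψ` -/

section General

variable {E : Type*} [NormedAddCommGroup E] [NormedSpace ℝ E] {H : Type*} [TopologicalSpace H]
  {I : ModelWithCorners ℝ E H} {M : Type*} [TopologicalSpace M] [ChartedSpace H M]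
  [IsManifold I ∞ M] {n : ℕ∞ω} {x : M}
  (g : PseudoRiemannianMetric I n E (TangentSpace I : M → Type _))
  [Fact (1 ≤ n)] [FiniteDimensional ℝ E] [CompleteSpace E] [g.HasLeviCivita]

/-- **`𝓛_{fX} g = f 𝓛_X g + df ⊗ X♭ + X♭ ⊗ df`.** For a vector field `X` and a function `f`, both
differentiable at `x`: `(𝓛_{fX} g)(V, W) = f (𝓛_X g)(V, W) + df(V) g(X, W) + df(W) g(V, X)` — the
tree's `∇`-formula `(𝓛_X g)(V,W) = g(∇_V X, W) + g(V, ∇_W X)` (`lieDerivBilin_val_apply`, `∇g = 0`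
discharged by `covDeriv₂_val_holds`) and the Leibniz rule `∇_V (fX) = f ∇_V X + df(V) X` of the
Levi-Civita connection. Wald 1984, (C.2.16). [cite: Wald1984GR, Appendix C.2, (C.2.16)] -/
theorem lieDerivBilin_smul_val_apply {X : Π x : M, TangentSpace I x} {f : M → ℝ}
    (hX : MDiffAt (T% X) x) (hf : MDiffAt f x) (V W : TangentSpace I x) :
    g.lieDerivBilin (f • X) g.val x V W =
      f x * g.lieDerivBilin X g.val x V W + mvfderiv I f x V * g.val x (X x) W +
        mvfderiv I f x W * g.val x V (X x) := by
  rw [g.lieDerivBilin_val_apply PseudoRiemannianMetric.covDeriv₂_val_holds,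
    g.lieDerivBilin_val_apply PseudoRiemannianMetric.covDeriv₂_val_holds,
    g.leviCivita.isCovariantDerivativeOnUniv.leibniz hX hf]
  simp only [add_apply, smul_apply,
    ContinuousLinearMap.smulRight_apply, map_add, map_smul, smul_eq_mul]
  ring

/-- **The gauge field of `fT` for a Killing field `T`**: `(𝓛_{fT} g)(V, W) = df(V) g(T, W) + df(W) g(V, T)`,
i.e. `𝓛_{fT} g = df ⊗ T♭ + T♭ ⊗ df` (`𝓛_T g = 0`, `IsKillingField.lieDerivBilin_val_eq_zero`), for `f`
differentiable at `x`. Wald 1984, (C.2.16) with (C.3.1). [cite: Wald1984GR, Appendix C.3, (C.3.1)] -/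
theorem lieDerivBilin_smul_val_apply_of_isKillingField {T : Π x : M, TangentSpace I x} {f : M → ℝ}
    (hT : g.IsKillingField T) (hf : MDiffAt f x) (V W : TangentSpace I x) :
    g.lieDerivBilin (f • T) g.val x V W =
      mvfderiv I f x V * g.val x (T x) W + mvfderiv I f x W * g.val x V (T x) := by
  have hn : (1 : ℕ∞ω) ≤ n := Fact.out
  have hTx : MDiffAt (T% T) x := (hT.contMDiff x).mdifferentiableAt (by
    intro h
    simp [h] at hn)
  rw [lieDerivBilin_smul_val_apply g hTx hf,
    PseudoRiemannianMetric.IsKillingField.lieDerivBilin_val_eq_zero g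
      PseudoRiemannianMetric.covDeriv₂_val_holds hT x]
  simp

omit [Fact (1 ≤ n)] [CompleteSpace E] in
/-- **The honest value of `∇k` under scalar differentiability.** If for all vector fields `X, Y`
differentiable at `x` the scalar function `y ↦ k_y(X_y, Y_y)` is differentiable at `x`, then the
trilinear map `g.covDeriv₂ k x` of `LeviCivita.lean` (defined by a `dif` on representability, junk `0`
otherwise) agrees with the classical formula `covDeriv₂Aux` on extended tangent vectors:
`(∇k)_x(X₀, Y₀, Z₀) = Z̃₀(k(X̃₀, Ỹ₀))(x) − k_x(∇_{Z₀} X̃₀, Y₀) − k_x(X₀, ∇_{Z₀} Ỹ₀)`. Same proof as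
`covDeriv₂_apply_extend` (`LeviCivitaCovDerivProofs.lean`: tensoriality in `X`, `Y` by the product and
Leibniz rules, in `Z` trivially; representability by `TensorialAt.mkHom₂`/`mkHom`), with the weaker
hypothesis replacing differentiability of `k` as a bundle section — which is all one knows cheaply of
`k = 𝓛_{ψT} g`. O'Neill 1983, Ch. 2, Prop. 2.2 and Thm. 2.15; Ch. 3, Def. 3.17. [folklore] -/
theorem covDeriv₂_apply_extend_of_forall
    {k : Π x : M, TangentSpace I x →L[ℝ] TangentSpace I x →L[ℝ] ℝ}
    (hk : ∀ X Y : Π x : M, TangentSpace I x, MDiffAt (T% X) x → MDiffAt (T% Y) x →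
      MDiffAt (fun y ↦ k y (X y) (Y y)) x)
    (X₀ Y₀ Z₀ : TangentSpace I x) :
    g.covDeriv₂ k x X₀ Y₀ Z₀ = g.covDeriv₂Aux k (extend E X₀) (extend E Y₀) (extend E Z₀) x := by
  -- tensoriality in the slot `X` (for `Y` differentiable at `x`)
  have t₁ : ∀ {Y : Π x : M, TangentSpace I x}, MDiffAt (T% Y) x →
      ∀ Z : Π x : M, TangentSpace I x, TensorialAt I E (fun X ↦ g.covDeriv₂Aux k X Y Z x) x := by
    intro Y hY Z
    refine ⟨fun {f X} hf hX ↦ ?_, fun {X X'} hX hX' ↦ ?_⟩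
    · have e1 : (fun y ↦ k y ((f • X) y) (Y y)) = f * fun y ↦ k y (X y) (Y y) := by
        funext y; simp [Pi.smul_apply', map_smul, smul_eq_mul]
      have hl : g.leviCivita (f • X) x =
          f x • g.leviCivita X x + (mvfderiv I f x).smulRight (X x) :=
        g.leviCivita.isCovariantDerivativeOnUniv.leibniz hX hf
      simp only [PseudoRiemannianMetric.covDeriv₂Aux]
      rw [e1, mvfderiv_mul hf (hk X Y hX hY), hl]
      simp only [add_apply, smul_apply,
        ContinuousLinearMap.smulRight_apply, Pi.smul_apply', map_add, map_smul, smul_eq_mul]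
      ring
    · have e1 : (fun y ↦ k y ((X + X') y) (Y y)) =
          (fun y ↦ k y (X y) (Y y)) + fun y ↦ k y (X' y) (Y y) := by
        funext y; simp [map_add]
      have hl : g.leviCivita (X + X') x = g.leviCivita X x + g.leviCivita X' x :=
        g.leviCivita.isCovariantDerivativeOnUniv.add hX hX'
      simp only [PseudoRiemannianMetric.covDeriv₂Aux]
      rw [e1, mvfderiv_add (hk X Y hX hY) (hk X' Y hX' hY), hl]
      simp only [add_apply, Pi.add_apply, map_add]
      ring
  -- tensoriality in the slot `Y` (for `X` differentiable at `x`)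
  have t₂ : ∀ {X : Π x : M, TangentSpace I x}, MDiffAt (T% X) x →
      ∀ Z : Π x : M, TangentSpace I x, TensorialAt I E (fun Y ↦ g.covDeriv₂Aux k X Y Z x) x := by
    intro X hX Z
    refine ⟨fun {f Y} hf hY ↦ ?_, fun {Y Y'} hY hY' ↦ ?_⟩
    · have e1 : (fun y ↦ k y (X y) ((f • Y) y)) = f * fun y ↦ k y (X y) (Y y) := by
        funext y; simp [Pi.smul_apply', map_smul, smul_eq_mul]
      have hl : g.leviCivita (f • Y) x =
          f x • g.leviCivita Y x + (mvfderiv I f x).smulRight (Y x) :=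
        g.leviCivita.isCovariantDerivativeOnUniv.leibniz hY hf
      simp only [PseudoRiemannianMetric.covDeriv₂Aux]
      rw [e1, mvfderiv_mul hf (hk X Y hX hY), hl]
      simp only [add_apply, smul_apply,
        ContinuousLinearMap.smulRight_apply, Pi.smul_apply', map_add, map_smul, smul_eq_mul]
      ring
    · have e1 : (fun y ↦ k y (X y) ((Y + Y') y)) =
          (fun y ↦ k y (X y) (Y y)) + fun y ↦ k y (X y) (Y' y) := by
        funext y; simp [map_add]
      have hl : g.leviCivita (Y + Y') x = g.leviCivita Y x + g.leviCivita Y' x :=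
        g.leviCivita.isCovariantDerivativeOnUniv.add hY hY'
      simp only [PseudoRiemannianMetric.covDeriv₂Aux]
      rw [e1, mvfderiv_add (hk X Y hX hY) (hk X Y' hX hY'), hl]
      simp only [add_apply, Pi.add_apply, map_add]
      ring
  -- representability (as in `exists_covDeriv₂_repr`)
  have hex : ∃ K : TangentSpace I x →L[ℝ] TangentSpace I x →L[ℝ] TangentSpace I x →L[ℝ] ℝ,
      ∀ X₀ Y₀ Z₀ : TangentSpace I x,
        K X₀ Y₀ Z₀ = g.covDeriv₂Aux k (extend E X₀) (extend E Y₀) (extend E Z₀) x := by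
    let L : (Π x : M, TangentSpace I x) → (Π x : M, TangentSpace I x) →
        (TangentSpace I x →L[ℝ] ℝ) := fun X Y ↦
      TensorialAt.mkHom (fun Z ↦ g.covDeriv₂Aux k X Y Z x) x
        (PseudoRiemannianMetric.tensorialAt_covDeriv₂Aux₃ k X Y)
    have hL : ∀ (X Y : Π x : M, TangentSpace I x) (Z₀ : TangentSpace I x),
        L X Y Z₀ = g.covDeriv₂Aux k X Y (extend E Z₀) x := fun X Y Z₀ ↦ rfl
    have hL₁ : ∀ Y : Π x : M, TangentSpace I x, MDiffAt (T% Y) x →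
        TensorialAt I E (L · Y) x := by
      intro Y hY
      refine ⟨fun {f X} hf hX ↦ ?_, fun {X X'} hX hX' ↦ ?_⟩
      · ext Z₀
        rw [hL, smul_apply, hL]
        exact (t₁ hY (extend E Z₀)).smul hf hX
      · ext Z₀
        rw [hL, add_apply, hL, hL]
        exact (t₁ hY (extend E Z₀)).add hX hX'
    have hL₂ : ∀ X : Π x : M, TangentSpace I x, MDiffAt (T% X) x →
        TensorialAt I E (L X ·) x := by
      intro X hX
      refine ⟨fun {f Y} hf hY ↦ ?_, fun {Y Y'} hY hY' ↦ ?_⟩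
      · ext Z₀
        rw [hL, smul_apply, hL]
        exact (t₂ hX (extend E Z₀)).smul hf hY
      · ext Z₀
        rw [hL, add_apply, hL, hL]
        exact (t₂ hX (extend E Z₀)).add hY hY'
    refine ⟨TensorialAt.mkHom₂ L x hL₁ hL₂, fun X₀ Y₀ Z₀ ↦ ?_⟩
    rw [TensorialAt.mkHom₂_apply_eq_extend, hL]
  simp only [PseudoRiemannianMetric.covDeriv₂, dif_pos hex]
  exact hex.choose_spec X₀ Y₀ Z₀

omit [IsManifold I ∞ M] [FiniteDimensional ℝ E] [CompleteSpace E] in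
/-- `d(νψ − ϖχ) = ν dψ − ϖ dχ` at a point where `ψ, χ` are differentiable (Mathlib's `mvfderiv`
calculus). [folklore] -/
private theorem mvfderiv_const_mul_sub_const_mul {ψ χ : M → ℝ} (ν ϖ : ℝ) (hψ : MDiffAt ψ x)
    (hχ : MDiffAt χ x) :
    mvfderiv I (fun y ↦ ν * ψ y - ϖ * χ y) x = ν • mvfderiv I ψ x - ϖ • mvfderiv I χ x := by
  have e : (fun y ↦ ν * ψ y - ϖ * χ y) = (fun _ ↦ ν) * ψ - (fun _ ↦ ϖ) * χ := by
    funext y; simp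
  rw [e, mvfderiv_sub (mdifferentiableAt_const.mul hψ) (mdifferentiableAt_const.mul hχ),
    mvfderiv_mul mdifferentiableAt_const hψ, mvfderiv_mul mdifferentiableAt_const hχ,
    mvfderiv_const, mvfderiv_const]
  simp

/-- **`𝓛_T 𝓛_{ψT} g = ν 𝓛_{ψT} g − ϖ 𝓛_{χT} g` for a Killing eigen-pair of functions.** Let `T` be a
Killing field of the `C^n` metric `g`, `n ≥ 2`, `U` open, `ψ, χ ∈ C²(U)` with `Tψ = νψ − ϖχ` on `U`.
Then at every `x ∈ U` the Lie derivative along `T` of the gauge field `h₁ = 𝓛_{ψT} g = dψ ⊗ T♭ + T♭ ⊗ dψ`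
is `ν h₁ − ϖ h₂`, `h₂ = 𝓛_{χT} g` (abstractly: `𝓛_T 𝓛_ξ g = 𝓛_{[T,ξ]} g + 𝓛_ξ 𝓛_T g = 𝓛_{(Tψ)T} g` for
`ξ = ψT`). Proof in the tree's `∇`-calculus: `(𝓛_T h₁)(V,W) = (∇_T h₁)(V,W) + h₁(∇_V T, W) + h₁(V, ∇_W T)`
(Wald (C.2.14)); `∇_T h₁` is evaluated on extended vectors `Ṽ, W̃` (`covDeriv₂_apply_extend_of_forall`)
and `T(h₁(Ṽ, W̃))` expanded by the product rule; `T g(T, W̃) = g(∇_T T, W) + g(T, ∇_T W̃)` (compatibility),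
`T(Ṽψ) = Ṽ(Tψ) + dψ([T, Ṽ]) = ν dψ(V) − ϖ dχ(V) + dψ(∇_T Ṽ − ∇_V T)` (`mvfderiv_apply_mlieBracket`,
torsion-freeness, and the eigen-equation differentiated along `Ṽ`, which is where openness of `U` is
used); all `∇_T Ṽ`, `∇_T W̃` terms cancel (tensoriality) and the remainder is `ν h₁ − ϖ h₂` plus
`dψ(V)·[g(∇_T T, W) + g(T, ∇_W T)] + dψ(W)·[g(∇_V T, T) + g(V, ∇_T T)]`, two instances of Killing's
equation (C.3.1). [cite: Wald1984GR, Appendix C.2–C.3, (C.2.14), (C.2.16), (C.3.1)] -/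
theorem lieDerivBilin_lieDerivBilin_smul_val (hn : 2 ≤ n) {T : Π x : M, TangentSpace I x}
    (hT : g.IsKillingField T) {U : Set M} (hU : IsOpen U) (hx : x ∈ U) {ν ϖ : ℝ} {ψ χ : M → ℝ}
    (hψ : ContMDiffOn I 𝓘(ℝ, ℝ) 2 ψ U) (hχ : ContMDiffOn I 𝓘(ℝ, ℝ) 2 χ U)
    (heig : ∀ y ∈ U, mvfderiv I ψ y (T y) = ν * ψ y - ϖ * χ y) :
    g.lieDerivBilin T (g.lieDerivBilin (ψ • T) g.val) x =
      ν • g.lieDerivBilin (ψ • T) g.val x - ϖ • g.lieDerivBilin (χ • T) g.val x := by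
  -- standing facts about `∇` and the fields
  have hLC : g.IsLeviCivita g.leviCivita := PseudoRiemannianMetric.isLeviCivita_leviCivita_holds
  have htors : ∀ {X Y : Π x : M, TangentSpace I x} {y : M}, MDiffAt (T% X) y →
      MDiffAt (T% Y) y →
        g.leviCivita Y y (X y) - g.leviCivita X y (Y y) = VectorField.mlieBracket I X Y y :=
    fun hX hY ↦ (g.leviCivita.torsion_eq_zero_iff).1 hLC.1 hX hY
  have hT2 : CMDiff 2 (T% T) := hT.contMDiff.of_le hn
  have hTd : ∀ y : M, MDiffAt (T% T) y := fun y ↦ (hT2 y).mdifferentiableAt two_ne_zero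
  have hUx : U ∈ 𝓝 x := hU.mem_nhds hx
  have hψx : CMDiffAt 2 ψ x := (hψ x hx).contMDiffAt hUx
  have hψd : ∀ y ∈ U, MDiffAt ψ y := fun y hy ↦
    ((hψ y hy).contMDiffAt (hU.mem_nhds hy)).mdifferentiableAt two_ne_zero
  have hχd : ∀ y ∈ U, MDiffAt χ y := fun y hy ↦
    ((hχ y hy).contMDiffAt (hU.mem_nhds hy)).mdifferentiableAt two_ne_zero
  -- the two gauge fields on `U`
  have hform : ∀ y ∈ U, ∀ V W : TangentSpace I y, g.lieDerivBilin (ψ • T) g.val y V W =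
      mvfderiv I ψ y V * g.val y (T y) W + mvfderiv I ψ y W * g.val y V (T y) :=
    fun y hy V W ↦ lieDerivBilin_smul_val_apply_of_isKillingField g hT (hψd y hy) V W
  have hform' : ∀ V W : TangentSpace I x, g.lieDerivBilin (χ • T) g.val x V W =
      mvfderiv I χ x V * g.val x (T x) W + mvfderiv I χ x W * g.val x V (T x) :=
    fun V W ↦ lieDerivBilin_smul_val_apply_of_isKillingField g hT (hχd x hx) V W
  -- differentiability of `y ↦ h₁ y (X y) (Y y)` at `x`
  have hk : ∀ X Y : Π x : M, TangentSpace I x, MDiffAt (T% X) x → MDiffAt (T% Y) x →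
      MDiffAt (fun y ↦ g.lieDerivBilin (ψ • T) g.val y (X y) (Y y)) x := by
    intro X Y hX hY
    have he : (fun y ↦ mvfderiv I ψ y (X y) * g.val y (T y) (Y y) +
        mvfderiv I ψ y (Y y) * g.val y (X y) (T y)) =ᶠ[𝓝 x]
        (fun y ↦ g.lieDerivBilin (ψ • T) g.val y (X y) (Y y)) := by
      filter_upwards [hUx] with y hy
      exact (hform y hy (X y) (Y y)).symm
    refine MDifferentiableAt.congr_of_eventuallyEq ?_ he.symm
    exact ((mdifferentiableAt_mvfderiv_apply hψx hX).mul
      (g.mdifferentiableAt_val_apply (hTd x) hY)).add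
      ((mdifferentiableAt_mvfderiv_apply hψx hY).mul (g.mdifferentiableAt_val_apply hX (hTd x)))
  ext V W
  -- extended vectors
  have hVt2 : CMDiffAt 2 (T% (extend E V : Π y : M, TangentSpace I y)) x :=
    contMDiffAt_extend (I := I) (F := E) V
  have hWt2 : CMDiffAt 2 (T% (extend E W : Π y : M, TangentSpace I y)) x :=
    contMDiffAt_extend (I := I) (F := E) W
  have hVtd : MDiffAt (T% (extend E V : Π y : M, TangentSpace I y)) x :=
    hVt2.mdifferentiableAt two_ne_zero
  have hWtd : MDiffAt (T% (extend E W : Π y : M, TangentSpace I y)) x :=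
    hWt2.mdifferentiableAt two_ne_zero
  -- Step A: the covariant-derivative term of `𝓛_T h₁`
  have hA : g.covDeriv₂ (g.lieDerivBilin (ψ • T) g.val) x V W (T x) =
      mvfderiv I (fun y ↦ g.lieDerivBilin (ψ • T) g.val y (extend E V y) (extend E W y)) x (T x)
        - g.lieDerivBilin (ψ • T) g.val x (g.leviCivita (extend E V) x (T x)) W
        - g.lieDerivBilin (ψ • T) g.val x V (g.leviCivita (extend E W) x (T x)) := by
    rw [covDeriv₂_apply_extend_of_forall g hk]
    simp only [PseudoRiemannianMetric.covDeriv₂Aux, extend_apply_self]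
  -- Step B: differentiate the product formula along `T x`
  have hB : mvfderiv I (fun y ↦ g.lieDerivBilin (ψ • T) g.val y (extend E V y) (extend E W y))
      x (T x) =
      mvfderiv I ψ x V * mvfderiv I (fun y ↦ g.val y (T y) (extend E W y)) x (T x)
        + g.val x (T x) W * mvfderiv I (fun y ↦ mvfderiv I ψ y (extend E V y)) x (T x)
        + (mvfderiv I ψ x W * mvfderiv I (fun y ↦ g.val y (extend E V y) (T y)) x (T x)
        + g.val x V (T x) * mvfderiv I (fun y ↦ mvfderiv I ψ y (extend E W y)) x (T x)) := by
    have he : (fun y ↦ g.lieDerivBilin (ψ • T) g.val y (extend E V y) (extend E W y)) =ᶠ[𝓝 x]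
        ((fun y ↦ mvfderiv I ψ y (extend E V y)) * (fun y ↦ g.val y (T y) (extend E W y)) +
          (fun y ↦ mvfderiv I ψ y (extend E W y)) * (fun y ↦ g.val y (extend E V y) (T y))) := by
      filter_upwards [hUx] with y hy
      simp only [Pi.add_apply, Pi.mul_apply]
      exact hform y hy _ _
    have ha : MDiffAt (fun y ↦ mvfderiv I ψ y (extend E V y)) x :=
      mdifferentiableAt_mvfderiv_apply hψx hVtd
    have hb : MDiffAt (fun y ↦ g.val y (T y) (extend E W y)) x :=
      g.mdifferentiableAt_val_apply (hTd x) hWtd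
    have hc : MDiffAt (fun y ↦ mvfderiv I ψ y (extend E W y)) x :=
      mdifferentiableAt_mvfderiv_apply hψx hWtd
    have hd : MDiffAt (fun y ↦ g.val y (extend E V y) (T y)) x :=
      g.mdifferentiableAt_val_apply hVtd (hTd x)
    rw [mvfderiv_congr_of_eventuallyEq he, mvfderiv_add (ha.mul hb) (hc.mul hd),
      mvfderiv_mul ha hb, mvfderiv_mul hc hd]
    simp only [add_apply, smul_apply, smul_eq_mul, extend_apply_self]
  -- Step C: the four derivatives along `T x`
  have hTa : mvfderiv I (fun y ↦ mvfderiv I ψ y (extend E V y)) x (T x) =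
      ν * mvfderiv I ψ x V - ϖ * mvfderiv I χ x V
        + mvfderiv I ψ x (g.leviCivita (extend E V) x (T x))
        - mvfderiv I ψ x (g.leviCivita T x V) := by
    have h1 := mvfderiv_apply_mlieBracket hψx (hT2 x) hVt2
    have h2 := htors (hTd x) hVtd
    have h3 : mvfderiv I (fun y ↦ mvfderiv I ψ y (T y)) x =
        ν • mvfderiv I ψ x - ϖ • mvfderiv I χ x := by
      rw [← mvfderiv_const_mul_sub_const_mul ν ϖ (hψd x hx) (hχd x hx)]
      refine mvfderiv_congr_of_eventuallyEq ?_
      filter_upwards [hUx] with y hy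
      exact heig y hy
    rw [h3, ← h2, extend_apply_self] at h1
    simp only [sub_apply, smul_apply, smul_eq_mul, map_sub] at h1
    linear_combination -h1
  have hTc : mvfderiv I (fun y ↦ mvfderiv I ψ y (extend E W y)) x (T x) =
      ν * mvfderiv I ψ x W - ϖ * mvfderiv I χ x W
        + mvfderiv I ψ x (g.leviCivita (extend E W) x (T x))
        - mvfderiv I ψ x (g.leviCivita T x W) := by
    have h1 := mvfderiv_apply_mlieBracket hψx (hT2 x) hWt2
    have h2 := htors (hTd x) hWtd
    have h3 : mvfderiv I (fun y ↦ mvfderiv I ψ y (T y)) x =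
        ν • mvfderiv I ψ x - ϖ • mvfderiv I χ x := by
      rw [← mvfderiv_const_mul_sub_const_mul ν ϖ (hψd x hx) (hχd x hx)]
      refine mvfderiv_congr_of_eventuallyEq ?_
      filter_upwards [hUx] with y hy
      exact heig y hy
    rw [h3, ← h2, extend_apply_self] at h1
    simp only [sub_apply, smul_apply, smul_eq_mul, map_sub] at h1
    linear_combination -h1
  have hTb : mvfderiv I (fun y ↦ g.val y (T y) (extend E W y)) x (T x) =
      g.val x (g.leviCivita T x (T x)) W + g.val x (T x) (g.leviCivita (extend E W) x (T x)) := by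
    have h := hLC.2 (hTd x) (hTd x) hWtd
    rw [extend_apply_self] at h
    exact h
  have hTd' : mvfderiv I (fun y ↦ g.val y (extend E V y) (T y)) x (T x) =
      g.val x (g.leviCivita (extend E V) x (T x)) (T x) + g.val x V (g.leviCivita T x (T x)) := by
    have h := hLC.2 (hTd x) hVtd (hTd x)
    rw [extend_apply_self] at h
    exact h
  -- Step D: Killing's equation at the two relevant pairs
  have hK1 := hT.2 x (T x) W
  have hK2 := hT.2 x V (T x)
  -- assemble
  rw [PseudoRiemannianMetric.lieDerivBilin_apply, hA, hB, hTa, hTb, hTc, hTd']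
  simp only [sub_apply, smul_apply, smul_eq_mul, hform x hx, hform']
  linear_combination (mvfderiv I ψ x V) * hK1 + (mvfderiv I ψ x W) * hK2

end General

/-! ## §2 Registered helper: the Killing eigen-equations of the gauge pair on a stationary hole -/

section Hole

/-- The d.o.c. of a stationary hole is open — fact-free on the boundaryless carrier
(`isOpen_chronologicalFuture/Past_of_boundaryless`). Chruściel–Costa 2008, §2.2. [folklore] -/
private theorem isOpen_doc' (𝓑 : StationaryAFBlackHole.{0}) : IsOpen 𝓑.doc :=
  (LorentzianMetric.isOpen_chronologicalFuture_of_boundaryless 𝓑.metric 𝓑.timeOrientation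
      𝓑.Mext).inter
    (LorentzianMetric.isOpen_chronologicalPast_of_boundaryless 𝓑.metric 𝓑.timeOrientation 𝓑.Mext)

/-- **The gauge pair of a scalar Killing-mode pair satisfies the Killing eigen-equations of
`IsGravitationalModePair` (clause (d), verbatim).** On a stationary hole `𝓑` with Killing field
`T = 𝓑.killing`, let `ψ, χ` be smooth on an open `U ⊇ d.o.c.` with `dψ(T) = νψ − ϖχ`, `dχ(T) = ϖψ + νχ`
on the d.o.c. (clauses (i), (iii) of `StationaryAFBlackHole.IsKillingModePair`, the wave equation and the
boundedness clause being irrelevant). Then the symmetric tensor fields `h₁ = 𝓛_{ψT} g`, `h₂ = 𝓛_{χT} g`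
satisfy `𝓛_T h₁ = ν h₁ − ϖ h₂` and `𝓛_T h₂ = ϖ h₁ + ν h₂` on the d.o.c.
(`lieDerivBilin_lieDerivBilin_smul_val` twice, the second time for the pair `(χ, ψ)` of rate `ν − iϖ`; the
d.o.c. is open). Registered helper of stub `stub_probeUniversality` (line symplectic-dual-of-the-bomb,
lead a2 wave 3): the honesty certificate that the gauge clause of `IsGravitationalModePair` is
load-bearing. [cite: Wald1984GR, Appendix C.2–C.3, (C.2.14)–(C.2.17), (C.3.1)] -/
theorem lieDerivBilin_smul_killing_eigenpair : ∀ (𝓑 : StationaryAFBlackHole.{0}) (U : Set 𝓑.carrier) (ν ϖ : ℝ) (ψ χ : 𝓑.carrier → ℝ), IsOpen U → 𝓑.doc ⊆ U → ContMDiffOn (𝓡 4) 𝓘(ℝ, ℝ) ((⊤ : ℕ∞) : WithTop ℕ∞) ψ U → ContMDiffOn (𝓡 4) 𝓘(ℝ, ℝ) ((⊤ : ℕ∞) : WithTop ℕ∞) χ U → (∀ x ∈ 𝓑.doc, mfderiv (𝓡 4) 𝓘(ℝ, ℝ) ψ x (𝓑.killing x) = ν * ψ x - ϖ * χ x ∧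 mfderiv (𝓡 4) 𝓘(ℝ, ℝ) χ x (𝓑.killing x) = ϖ * ψ x + ν * χ x) → haveI : 𝓑.metric.HasLeviCivita := 𝓑.metric.hasLeviCivita; ∀ p ∈ 𝓑.doc, 𝓑.metric.toPseudoRiemannianMetric.lieDerivBilin 𝓑.killing (𝓑.metric.toPseudoRiemannianMetric.lieDerivBilin (ψ • 𝓑.killing) 𝓑.metric.val) p = ν • 𝓑.metric.toPseudoRiemannianMetric.lieDerivBilin (ψ • 𝓑.killing) 𝓑.metric.val p - ϖ • 𝓑.metric.toPseudoRiemannianMetric.lieDerivBilin (χ • 𝓑.killing) 𝓑.metric.val p ∧ 𝓑.metric.toPseudoRiemannianMetric.lieDerivBilin 𝓑.killing (𝓑.metric.toPseudoRiemannianMetric.lieDerivBilin (χ • 𝓑.killing) 𝓑.metric.val) p = ϖ • 𝓑.metric.toPseudoRiemannianMetric.lieDerivBilin (ψ • 𝓑.killing) 𝓑.metric.val p + ν • 𝓑.metric.toPseudoRiemannianMetric.lieDerivBilin (χ • 𝓑.killing) 𝓑.metric.val p := by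
  intro 𝓑 U ν ϖ ψ χ hU hdoc hψ hχ heig p hp
  haveI : 𝓑.metric.HasLeviCivita := 𝓑.metric.hasLeviCivita
  have hdo : IsOpen 𝓑.doc := isOpen_doc' 𝓑
  have hT : 𝓑.metric.toPseudoRiemannianMetric.IsKillingField 𝓑.killing :=
    𝓑.isStationary.isKillingField
  have h2 : (2 : ℕ∞ω) ≤ ((⊤ : ℕ∞) : WithTop ℕ∞) := WithTop.coe_le_coe.mpr le_top
  have hψ2 : ContMDiffOn (𝓡 4) 𝓘(ℝ, ℝ) 2 ψ 𝓑.doc := (hψ.of_le h2).mono hdoc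
  have hχ2 : ContMDiffOn (𝓡 4) 𝓘(ℝ, ℝ) 2 χ 𝓑.doc := (hχ.of_le h2).mono hdoc
  have hψe : ∀ y ∈ 𝓑.doc, mvfderiv (𝓡 4) ψ y (𝓑.killing y) = ν * ψ y - ϖ * χ y :=
    fun y hy ↦ (heig y hy).1
  have hχe : ∀ y ∈ 𝓑.doc, mvfderiv (𝓡 4) χ y (𝓑.killing y) = ν * χ y - (-ϖ) * ψ y := by
    intro y hy
    have e : mvfderiv (𝓡 4) χ y (𝓑.killing y) = ϖ * ψ y + ν * χ y := (heig y hy).2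
    rw [e]
    ring
  refine ⟨lieDerivBilin_lieDerivBilin_smul_val _ h2 hT hdo hp hψ2 hχ2 hψe, ?_⟩
  rw [lieDerivBilin_lieDerivBilin_smul_val _ h2 hT hdo hp hχ2 hψ2 hχe, neg_smul, sub_neg_eq_add,
    add_comm]

end Hole

end Summit.FinalStateConjecture.FinalStateConjecture.Theorems.SymplecticDualOfTheBomb

end
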